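import Literature.Computability.AlgebraicComplexity.BrentFormulaDepth
import HarnessLib

/-!
# Brent's depth reduction in the tree's circuit measures: depth of the formula combinators, and
`D(f) ≤ T(f) ≤ 8 log₂ (E(f) + 1)` (BCS (21.35), upper bound)

`BrentFormulaDepth.lean` proves Brent's theorem for the weighted expressions `WExpr` (their own
`WExpr.depth`). This companion transports it to the tree's list-presented circuits: the DEPTH
(`ArithCircuit.depth`, `CircuitDepth.lean`: longest input–output path, unit weight per gate) of the
formula combinators `lin` / `add` / `mul` / `smul` is computed (the depth API these combinators were
missing: `ArithCircuit.depth_lin`, `depth_add`, `depth_mul`, `depth_smul`, from the depth-list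
analogue `gateWDepths_append_of_shift` of `gateValues_append`), every weighted expression is realised
by a fan-in-two FORMULA of the same depth (`WExpr.exists_formula_depth_eq`), and hence

  `exists_formula_depth_le_log : ∀ f, ∃ P, P.WellFormed ∧ P.IsFormula ∧ P.IsFanInTwo ∧ P.eval = f ∧
     P.depth ≤ Nat.log 2 ((formulaComplexity f + 1) ^ 8)`

— Bürgisser–Clausen–Shokrollahi (21.35) (Brent) "`D(f) ≤ (2/log ε) log E(f) + 1`" with the tree's
measures (`formulaComplexity` = `E`, formula depth bounding the straight-line depth `D ≤ T`,
Rem. (21.34)(2)) and the unoptimised constant of `WExpr.exists_depth_le_log`.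

Theorem-only file (no definition, no named fact); no `instance`, no `notation`. `VP ≠ VNP` is not
touched by anything here.

## References
* [BurgisserClausenShokrollahi1997] P. Bürgisser, M. Clausen, M. A. Shokrollahi, *Algebraic
  Complexity Theory*, Springer 1997, Thm. (21.35) (Brent) and Rem. (21.34), p. 592.
* [Burgisser2000] P. Bürgisser, *Completeness and Reduction in Algebraic Complexity Theory*,
  Springer 2000, Def. 2.1 (depth of straight-line programs), proof of Prop. 2.3 (composition).
-/

noncomputable section

open MvPolynomial

namespace Literature.Computability.AlgebraicComplexity

universe u v

namespace ArithCircuit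

variable {k : Type u} {σ : Type v}

/-! ## Depth lists of sequential compositions -/

/-- A shifted operand reads the depths appended after the shift point (depth-list analogue of
`Operand.eval_shift_append`). [cite: Burgisser2000, proof of Prop. 2.3] -/
theorem Operand.depthIn_shift_append (ds ds' : List ℕ) (u : Operand k σ) :
    (u.shift ds.length).depthIn (ds ++ ds') = u.depthIn ds' := by
  cases u with
  | var i => rfl
  | const c => rfl
  | gate j =>
    simp [Operand.shift, Operand.depthIn, List.getD_eq_getElem?_getD,
      List.getElem?_append_right (Nat.le_add_left ds.length j)]

/-- A truncated operand reads the depths before the truncation point (depth-list analogue of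
`Operand.eval_truncate_append`). [cite: Burgisser2000, Def. 2.1] -/
theorem Operand.depthIn_truncate_append [Zero k] (ds ds' : List ℕ) (u : Operand k σ) :
    (u.truncate ds.length).depthIn (ds ++ ds') = u.depthIn ds := by
  cases u with
  | var i => rfl
  | const c => rfl
  | gate j =>
    by_cases h : j < ds.length
    · simp [Operand.truncate, Operand.depthIn, h, List.getD_eq_getElem?_getD,
        List.getElem?_append_left h]
    · simp [Operand.truncate, Operand.depthIn, h, List.getD_eq_getElem?_getD]

/-- The operands of a shifted gate are the shifted operands (private copy; the public name lives in a
Summits junk-guard file). [cite: Burgisser2000, proof of Prop. 2.3] -/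
private theorem Gate.args_shift_bd (n : ℕ) (g : Gate k σ) : (g.shift n).args = g.args.map (Operand.shift n) := by
  cases g with
  | sum args => simp [Gate.shift, Gate.args, List.map_map, Function.comp_def]
  | prod args => simp [Gate.shift, Gate.args]

/-- A shifted gate has its weighted depth computed against the appended depth list (shift-invariant
weights, e.g. the unit weight of `depth`). [cite: Burgisser2000, proof of Prop. 2.3] -/
private theorem gate_wdepth_shift_append (w : Gate k σ → ℕ) (hw : ∀ n g, w (Gate.shift n g) = w g)
    (pre ds : List ℕ) (g : Gate k σ) :
    w (g.shift pre.length) + (((g.shift pre.length).args.map (Operand.depthIn (pre ++ ds))).foldr max 0) =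
      w g + ((g.args.map (Operand.depthIn ds)).foldr max 0) := by
  rw [hw, Gate.args_shift_bd, List.map_map]
  congr 2
  refine List.map_congr_left fun u _ => ?_
  exact Operand.depthIn_shift_append pre ds u

/-- The left fold over shifted gates with a prefix of depths. [cite: Burgisser2000, proof of Prop. 2.3] -/
private theorem foldl_shift_depth_aux (w : Gate k σ → ℕ) (hw : ∀ n g, w (Gate.shift n g) = w g)
    (pre : List ℕ) (gs : List (Gate k σ)) (ds : List ℕ) :
    (gs.map (Gate.shift pre.length)).foldl
        (fun ds g => ds ++ [w g + ((g.args.map (Operand.depthIn ds)).foldr max 0)]) (pre ++ ds) =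
      pre ++ gs.foldl (fun ds g => ds ++ [w g + ((g.args.map (Operand.depthIn ds)).foldr max 0)]) ds := by
  induction gs generalizing ds with
  | nil => simp
  | cons g rest ih =>
    simp only [List.map_cons, List.foldl_cons]
    rw [gate_wdepth_shift_append w hw, List.append_assoc, ih]

/-- **The depth list of a sequential composition is the concatenation of the depth lists** (for
shift-invariant gate weights) — depth-list analogue of `gateValues_append`.
[cite: Burgisser2000, proof of Prop. 2.3] -/
theorem gateWDepths_append_of_shift (w : Gate k σ → ℕ) (hw : ∀ n g, w (Gate.shift n g) = w g)
    (P Q : ArithCircuit k σ) :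
    gateWDepths w (P.append Q).gates = gateWDepths w P.gates ++ gateWDepths w Q.gates := by
  show gateWDepths w (P.gates ++ Q.gates.map (Gate.shift P.size)) = _
  have hP : P.size = (gateWDepths w P.gates).length := (gateWDepths_length w P.gates).symm
  unfold gateWDepths
  rw [List.foldl_append, hP]
  have := foldl_shift_depth_aux w hw (gateWDepths w P.gates) Q.gates []
  simpa [gateWDepths] using this

/-- The depth list of `append P Q` for the unit weight. [cite: Burgisser2000, proof of Prop. 2.3] -/
theorem gateWDepths_one_append (P Q : ArithCircuit k σ) :
    gateWDepths (fun _ => 1) (P.append Q).gates =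
      gateWDepths (fun _ => 1) P.gates ++ gateWDepths (fun _ => 1) Q.gates :=
  gateWDepths_append_of_shift _ (fun _ _ => rfl) P Q

/-! ## Depth of the formula combinators -/

/-- A gate-free circuit has depth `0`. [cite: Burgisser2000, Def. 2.1] -/
theorem depth_eq_zero_of_size_eq_zero (P : ArithCircuit k σ) (h : P.size = 0) : P.depth = 0 := by
  have hg : P.gates = [] := List.eq_nil_of_length_eq_zero h
  unfold depth wdepth
  rw [hg]
  cases P.output with
  | var i => rfl
  | const c => rfl
  | gate j => simp [Operand.depthIn, gateWDepths]

/-- Depth of "`append P Q` followed by one binary gate reading the two outputs": one more than the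
larger of the two depths (generic form of `depth_lin` / `depth_add` / `depth_mul`).
[cite: Burgisser2000, Def. 2.1 and proof of Prop. 2.3] -/
private theorem depth_append_binop [Zero k] (P Q : ArithCircuit k σ) (g : Gate k σ)
    (hg : g.args = [P.output.truncate P.size, Q.output.shift P.size]) :
    (⟨(P.append Q).gates ++ [g], .gate (P.size + Q.size)⟩ : ArithCircuit k σ).depth =
      max P.depth Q.depth + 1 := by
  have hP := gateWDepths_length (fun _ : Gate k σ => (1 : ℕ)) P.gates
  have hQ := gateWDepths_length (fun _ : Gate k σ => (1 : ℕ)) Q.gates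
  have h1 : Operand.depthIn (gateWDepths (fun _ => 1) P.gates ++ gateWDepths (fun _ => 1) Q.gates)
      (P.output.truncate P.size) = P.output.depthIn (gateWDepths (fun _ => 1) P.gates) := by
    have := Operand.depthIn_truncate_append (k := k) (gateWDepths (fun _ => 1) P.gates)
      (gateWDepths (fun _ => 1) Q.gates) P.output
    rw [hP] at this; exact this
  have h2 : Operand.depthIn (gateWDepths (fun _ => 1) P.gates ++ gateWDepths (fun _ => 1) Q.gates)
      (Q.output.shift P.size) = Q.output.depthIn (gateWDepths (fun _ => 1) Q.gates) := by
    have := Operand.depthIn_shift_append (k := k) (gateWDepths (fun _ => 1) P.gates)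
      (gateWDepths (fun _ => 1) Q.gates) Q.output
    rw [hP] at this; exact this
  have hlen : (gateWDepths (fun _ => 1) P.gates ++ gateWDepths (fun _ => 1) Q.gates).length =
      P.size + Q.size := by
    rw [List.length_append, hP, hQ]; rfl
  unfold depth wdepth
  rw [gateWDepths_append_singleton, gateWDepths_one_append, hg]
  show (gateWDepths (fun _ => 1) P.gates ++ gateWDepths (fun _ => 1) Q.gates ++ _).getD
    (P.size + Q.size) 0 = _
  rw [List.getD_eq_getElem?_getD, List.getElem?_append_right (by rw [hlen]), hlen, Nat.sub_self]
  simp only [List.map_cons, List.map_nil, List.foldr_cons, List.foldr_nil,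
    List.getElem?_cons_zero, Option.getD_some]
  rw [h1, h2, Nat.max_zero, Nat.add_comm]

/-- **`depth (c₁ P + c₂ Q) = max (depth P) (depth Q) + 1`** for the weighted-sum combinator `lin`.
[cite: Burgisser2000, Def. 2.1] -/
theorem depth_lin [Zero k] (c₁ : k) (P : ArithCircuit k σ) (c₂ : k) (Q : ArithCircuit k σ) :
    (lin c₁ P c₂ Q).depth = max P.depth Q.depth + 1 :=
  depth_append_binop P Q _ rfl

/-- **`depth (P + Q) = max (depth P) (depth Q) + 1`**. [cite: Burgisser2000, Def. 2.1] -/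
theorem depth_add [CommSemiring k] (P Q : ArithCircuit k σ) :
    (P.add Q).depth = max P.depth Q.depth + 1 :=
  depth_append_binop P Q _ rfl

/-- **`depth (P * Q) = max (depth P) (depth Q) + 1`**. [cite: Burgisser2000, Def. 2.1] -/
theorem depth_mul [Zero k] (P Q : ArithCircuit k σ) :
    (P.mul Q).depth = max P.depth Q.depth + 1 :=
  depth_append_binop P Q _ rfl

/-- **`depth (c • P) = depth P + 1`**. [cite: Burgisser2000, Def. 2.1] -/
theorem depth_smul (c : k) (P : ArithCircuit k σ) : (P.smul c).depth = P.depth + 1 := by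
  have hP := gateWDepths_length (fun _ : Gate k σ => (1 : ℕ)) P.gates
  unfold depth wdepth
  show (gateWDepths (fun _ => 1) (P.gates ++ [Gate.sum [(c, P.output)]])).getD P.size 0 = _
  rw [gateWDepths_append_singleton, List.getD_eq_getElem?_getD,
    List.getElem?_append_right (by rw [hP]; exact le_rfl), hP, show P.size - P.gates.length = 0 from
      Nat.sub_self _]
  simp only [Gate.args, List.map_cons, List.map_nil, List.foldr_cons, List.foldr_nil,
    List.getElem?_cons_zero, Option.getD_some, Nat.max_zero, Nat.add_comm]

/-! ## Well-formedness of the product combinator (public twin of a private tree lemma) -/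

/-- Shifting references preserves `RefsBelow` with the shifted bound. [cite: Burgisser2000, Def. 2.1] -/
private theorem refsBelow_shift_bd (n : ℕ) {m : ℕ} {u : Operand k σ} (h : u.RefsBelow m) :
    (u.shift n).RefsBelow (m + n) := by
  cases u with
  | var i => trivial
  | const c => trivial
  | gate j => change j + n < m + n; change j < m at h; omega

/-- `RefsBelow` is monotone in the bound. [cite: Burgisser2000, Def. 2.1] -/
private theorem refsBelow_mono_bd {m m' : ℕ} (h : m ≤ m') {u : Operand k σ} (hu : u.RefsBelow m) :
    u.RefsBelow m' := by
  cases u with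
  | var i => trivial
  | const c => trivial
  | gate j => change j < m'; change j < m at hu; omega

/-- A truncated operand refers below the truncation point. [cite: Burgisser2000, Def. 2.1] -/
private theorem refsBelow_truncate_bd [Zero k] (n : ℕ) (u : Operand k σ) :
    (u.truncate n).RefsBelow n := by
  cases u with
  | var i => trivial
  | const c => trivial
  | gate j =>
    by_cases h : j < n
    · simp only [Operand.truncate, h, if_true]; exact h
    · simp only [Operand.truncate, h, if_false]; trivial

/-- **`mul` preserves well-formedness**: the gates of `P`, the shifted gates of `Q`, and one top
product gate reading the two (truncated, resp. shifted) outputs (public twin of the private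
`WellFormed.mul` of `CircuitDepthProofs.lean`, proof as `WellFormed.lin`).
[cite: Burgisser2000, Def. 2.1 and proof of Prop. 2.3] -/
theorem WellFormed.mul_wf [Zero k] {P Q : ArithCircuit k σ} (hP : P.WellFormed)
    (hQ : Q.WellFormed) : (P.mul Q).WellFormed := by
  have hlen : (P.append Q).gates.length = P.size + Q.size := size_append P Q
  refine ⟨?_, ?_⟩
  · intro i g hg u hu
    change ((P.append Q).gates ++ _)[i]? = some g at hg
    by_cases hi : i < (P.append Q).gates.length
    · rw [List.getElem?_append_left hi] at hg
      simp only [append] at hg hi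
      by_cases hiP : i < P.gates.length
      · rw [List.getElem?_append_left hiP] at hg
        exact hP.1 i g hg u hu
      · push Not at hiP
        rw [List.getElem?_append_right hiP, List.getElem?_map] at hg
        obtain ⟨g0, hg0, rfl⟩ := Option.map_eq_some_iff.1 hg
        rw [Gate.args_shift_bd, List.mem_map] at hu
        obtain ⟨u0, hu0, rfl⟩ := hu
        have h0 := hQ.1 _ g0 hg0 u0 hu0
        have := refsBelow_shift_bd P.size h0
        have hsz : P.size = P.gates.length := rfl
        exact refsBelow_mono_bd (by omega) this
    · push Not at hi
      rw [List.getElem?_append_right hi] at hg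
      have hi0 : i - (P.append Q).gates.length = 0 := by
        rcases Nat.eq_zero_or_pos (i - (P.append Q).gates.length) with h | h
        · exact h
        · rw [List.getElem?_eq_none_iff.2 (by simp; omega)] at hg
          exact absurd hg (by simp)
      rw [hi0] at hg
      simp only [List.getElem?_cons_zero, Option.some.injEq] at hg
      subst hg
      simp only [Gate.args, List.mem_cons, List.not_mem_nil, or_false] at hu
      rcases hu with rfl | rfl
      · exact refsBelow_mono_bd (by omega) (refsBelow_truncate_bd P.size P.output)
      · have := refsBelow_shift_bd P.size hQ.2
        exact refsBelow_mono_bd (by omega) this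
  · show P.size + Q.size < ((P.append Q).gates ++ [_]).length
    rw [List.length_append, List.length_singleton, hlen]
    exact Nat.lt_succ_self _

end ArithCircuit

/-! ## Weighted expressions are formulas of the same depth -/

namespace WExpr

variable {k : Type u} {σ : Type v} [CommSemiring k]

/-- **Every weighted expression is computed by a well-formed fan-in-two formula with at most
`size e` gates and of depth exactly `depth e`** (the transport `WExpr.exists_formula` with depth
bookkeeping). [cite: BurgisserClausenShokrollahi1997, §21.1 p. 549 and Rem. (21.34)(2)] -/
theorem exists_formula_depth_eq (e : WExpr k σ) :
    ∃ P : ArithCircuit k σ, P.WellFormed ∧ P.IsFormula ∧ P.IsFanInTwo ∧ P.eval = e.eval ∧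
      P.size ≤ e.size ∧ P.depth = e.depth := by
  induction e with
  | var i =>
    obtain ⟨P, h1, h2, h3, h4, h5⟩ := ArithCircuit.exists_formula_X (k := k) i
    exact ⟨P, h1, h2, h3, by rw [h4, eval_var], by rw [size_var]; exact h5,
      by rw [depth_var]; exact P.depth_eq_zero_of_size_eq_zero (Nat.le_zero.1 h5)⟩
  | const c =>
    obtain ⟨P, h1, h2, h3, h4, h5⟩ := ArithCircuit.exists_formula_C (σ := σ) c
    exact ⟨P, h1, h2, h3, by rw [h4, eval_const], by rw [size_const]; exact h5,
      by rw [depth_const]; exact P.depth_eq_zero_of_size_eq_zero (Nat.le_zero.1 h5)⟩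
  | lin c₁ e₁ c₂ e₂ ih₁ ih₂ =>
    obtain ⟨P, hPw, hPf, hP2, hPe, hPs, hPd⟩ := ih₁
    obtain ⟨Q, hQw, hQf, hQ2, hQe, hQs, hQd⟩ := ih₂
    refine ⟨ArithCircuit.lin c₁ P c₂ Q, hPw.lin hQw, hPf.lin hQf hPw hQw, hP2.lin hQ2, ?_, ?_, ?_⟩
    · rw [ArithCircuit.lin_eval, hPe, hQe, eval_lin]
    · rw [ArithCircuit.size_lin, size_lin]; omega
    · rw [ArithCircuit.depth_lin, hPd, hQd, depth_lin]
  | mul e₁ e₂ ih₁ ih₂ =>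
    obtain ⟨P, hPw, hPf, hP2, hPe, hPs, hPd⟩ := ih₁
    obtain ⟨Q, hQw, hQf, hQ2, hQe, hQs, hQd⟩ := ih₂
    refine ⟨P.mul Q, hPw.mul_wf hQw, hPf.mul hQf hPw hQw, hP2.mul hQ2,
      ?_, ?_, ?_⟩
    · rw [ArithCircuit.mul_eval, hPe, hQe, eval_mul]
    · rw [ArithCircuit.size_mul, size_mul]; omega
    · rw [ArithCircuit.depth_mul, hPd, hQd, depth_mul]

end WExpr

/-! ## Brent's theorem in the tree's measures -/

section Brent

variable {k : Type u} {σ : Type v} [CommSemiring k]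

/-- **Brent's theorem (BCS (21.35)), upper bound, for `formulaComplexity` and `ArithCircuit.depth`**:
every polynomial `f` is computed by a well-formed fan-in-two FORMULA of depth
`≤ log₂ ((E(f) + 1)^8) ≤ 8 log₂ (E(f) + 1)`, `E(f) = formulaComplexity f` — hence the straight-line
depth `D(f)` and the formula depth `T(f)` are `O(log E(f))` (printed: `D(f) ≤ (2/log ε) log E(f) + 1`;
constant unoptimised here). [cite: BurgisserClausenShokrollahi1997, Thm. (21.35) (Brent) and Rem. (21.34)(2), p. 592] -/
theorem exists_formula_depth_le_log (f : MvPolynomial σ k) :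
    ∃ P : ArithCircuit k σ, P.WellFormed ∧ P.IsFormula ∧ P.IsFanInTwo ∧ P.eval = f ∧
      P.depth ≤ Nat.log 2 ((formulaComplexity f + 1) ^ 8) := by
  obtain ⟨e, he, hs⟩ := exists_wexpr_size_le_formulaComplexity f
  obtain ⟨e', he', hd⟩ := e.exists_depth_le_log
  obtain ⟨P, hPw, hPf, hP2, hPe, -, hPd⟩ := e'.exists_formula_depth_eq
  refine ⟨P, hPw, hPf, hP2, by rw [hPe, he', he], ?_⟩
  rw [hPd]
  exact hd.trans (Nat.log_mono_right (Nat.pow_le_pow_left (Nat.succ_le_succ hs) 8))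

/-- Polynomial form: a formula for `f` with `4 ^ depth ≤ (E(f) + 1) ^ 16`.
[cite: BurgisserClausenShokrollahi1997, Thm. (21.35) (Brent), p. 592] -/
theorem exists_formula_four_pow_depth_le (f : MvPolynomial σ k) :
    ∃ P : ArithCircuit k σ, P.WellFormed ∧ P.IsFormula ∧ P.IsFanInTwo ∧ P.eval = f ∧
      4 ^ P.depth ≤ (formulaComplexity f + 1) ^ 16 := by
  obtain ⟨e, he, hs⟩ := exists_wexpr_size_le_formulaComplexity f
  obtain ⟨e', he', hd⟩ := e.exists_four_pow_depth_le
  obtain ⟨P, hPw, hPf, hP2, hPe, -, hPd⟩ := e'.exists_formula_depth_eq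
  refine ⟨P, hPw, hPf, hP2, by rw [hPe, he', he], ?_⟩
  rw [hPd]
  exact hd.trans (Nat.pow_le_pow_left (Nat.succ_le_succ hs) 16)

/-- **BCS (21.35) / Rem. (21.34), lower bound, for the tree's measures: `E(f) + 1 ≤ 2^{D}`** for
every fan-in-two circuit of depth `D` computing `f` — unfold the circuit into a weighted expression
of depth `≤ D` (`ArithCircuit.depth_toWExpr_le`), whose size bounds `E(f)`
(`WExpr.formulaComplexity_eval_le`) and is `< 2^{depth}` (`WExpr.size_succ_le_two_pow_depth`).
[cite: BurgisserClausenShokrollahi1997, Thm. (21.35) (Brent) lower bound and Rem. (21.34)(2), p. 592] -/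
theorem formulaComplexity_succ_le_two_pow_depth {P : ArithCircuit k σ} (h2 : P.IsFanInTwo) :
    formulaComplexity P.eval + 1 ≤ 2 ^ P.depth := by
  have h1 : formulaComplexity P.eval ≤ P.toWExpr.size := by
    rw [← ArithCircuit.eval_toWExpr]; exact P.toWExpr.formulaComplexity_eval_le
  calc formulaComplexity P.eval + 1 ≤ P.toWExpr.size + 1 := Nat.succ_le_succ h1
    _ ≤ 2 ^ P.toWExpr.depth := P.toWExpr.size_succ_le_two_pow_depth
    _ ≤ 2 ^ P.depth := Nat.pow_le_pow_right (by norm_num) (ArithCircuit.depth_toWExpr_le h2)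

/-- **`log₂ (E(f) + 1) ≤ D(f)`**: every fan-in-two circuit computing `f` has depth at least
`log₂ (formulaComplexity f + 1)`; with `exists_formula_depth_le_log` both directions of Brent's
theorem (21.35) hold for `formulaComplexity` and `ArithCircuit.depth`.
[cite: BurgisserClausenShokrollahi1997, Thm. (21.35) (Brent), p. 592] -/
theorem log_formulaComplexity_succ_le_depth {P : ArithCircuit k σ} (h2 : P.IsFanInTwo) :
    Nat.log 2 (formulaComplexity P.eval + 1) ≤ P.depth :=
  calc Nat.log 2 (formulaComplexity P.eval + 1) ≤ Nat.log 2 (2 ^ P.depth) :=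
      Nat.log_mono_right (formulaComplexity_succ_le_two_pow_depth h2)
    _ = P.depth := Nat.log_pow (by norm_num) _

end Brent

end Literature.Computability.AlgebraicComplexity

end
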